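import Literature.Algebra.Homology.OrderedCechSystemFullRing
import HarnessLib

/-!
# Refinement along an index map = restrict ∘ pull back ∘ extend (The Stacks Project, Tag 01FG)

Topic `Algebra/Homology`; namespace `Literature.Algebra.Homology.OrderedCech.Full`.  PROOF file (theorems only; no definition,
no named fact, no instance, no notation, no `sorry`).  Cell `hodgecm-mathlib` FLOOR 0, P1 sub-line F-11, packet (iv)∕J3 —
HOWTO (c) of F0P1b-p01 (g0) for F0P1b-p02∕p04 (g0).

For a map of index sets `τ : ι′ → ι`, coefficient systems `M` on `ι`, `M′` on `ι′` and a comparison `φ : τ(·)^* M ⟶ M′`, the tree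
has two pull-backs of Čech cochains along `τ`: the ORDERED refinement ★ `OrderedCech.refineCochain τ φ` (`Algebra/Homology/
OrderedCechSystemAlternating`: `(τ^♯ g)_{σ′} = φ (g.altEvalAt (τ ∘ e_{σ′}))`, alternating evaluation at the possibly non-monotone,
possibly non-injective tuple `τ ∘ e_{σ′}`) and the ORDER-FREE pull-back ★ `OrderedCech.Full.pullbackCochain τ φ` of full cochains
(`Algebra/Homology/OrderedCechSystemFull`).  **`Full.res_pullbackCochain_ext`**: they agree through the restriction∕extension pair
★ `Full.res` ∕ ★ `Full.ext` — `τ^♯ = res ∘ Θ_τ ∘ ext` on cochains.  Consequently (with ★ `Full.pullbackCochain_cup`, ★ `Full.res_cup`,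
★ `Full.d_ext`, ★ `Full.sysD_res` and the injectivity of `H(res)`, ★ `Modules/CechFullToOrderedElementwise`) every refinement map is
multiplicative on Čech cohomology although `τ ∘ e_{σ′}` need not be increasing.

## References
* The Stacks Project, Tag 01FG (Čech complex and refinements), Tag 01FP (cup product). [StacksProject]
* U. Görtz, T. Wedhorn, *Algebraic Geometry II* (2023), Def. 21.68 (p. 180), (21.29). [GortzWedhorn2023]
-/

universe v u

open CategoryTheory

set_option backward.isDefEq.respectTransparency false -- `ModuleCat`-valued functors (as in ★ `OrderedCechSystem`)

noncomputable section

namespace Literature.Algebra.Homology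

namespace OrderedCech

namespace Full

variable {ι : Type} [LinearOrder ι] {A : Type u} [CommRing A] {M : Finset ι ⥤ ModuleCat.{v} A}
  {ι' : Type} [LinearOrder ι'] {M' : Finset ι' ⥤ ModuleCat.{v} A} (τ : ι' → ι) (φ : imageFunctor τ ⋙ M ⟶ M')

omit [LinearOrder ι'] in
/-- Naturality of `φ` against pushing a signed value from `τ(s′)` to `τ(t′)`. [cite: StacksProject, Tag 01FG] -/
theorem map_app_altEvalAt {n : ℤ} (g : SysCochain M n) {m : ℕ} (α : Fin m → ι) {s' t' : Finset ι'}
    (hst : s' ⊆ t') (hα : Finset.univ.image α ⊆ s'.image τ) :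
    (M'.map (homOfLE hst)).hom ((φ.app s').hom (g.altEvalAt α (s'.image τ))) =
      (φ.app t').hom (g.altEvalAt α (t'.image τ)) := by
  classical
  have hnat := φ.naturality (homOfLE hst)
  have h1 : (M'.map (homOfLE hst)).hom ((φ.app s').hom (g.altEvalAt α (s'.image τ))) =
      (φ.app s' ≫ M'.map (homOfLE hst)).hom (g.altEvalAt α (s'.image τ)) := rfl
  rw [h1, ← hnat]
  change (φ.app t').hom ((M.map (homOfLE (Finset.image_subset_image hst))).hom (g.altEvalAt α (s'.image τ))) = _
  congr 1
  exact SysCochain.map_altEvalAt g α _ _ hα _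

omit [LinearOrder ι'] in
/-- The alternating evaluation at `τ ∘ e_s` does not depend on how the length of the sorted enumeration `e_s` of `s` is
written. [cite: StacksProject, Tag 01FG] -/
theorem altEvalAt_comp_orderEmbOfFin_congr [LinearOrder ι'] {n : ℤ} (g : SysCochain M n) (s : Finset ι') {m₁ m₂ : ℕ}
    (h₁ : s.card = m₁) (h₂ : s.card = m₂) (t : Finset ι) :
    g.altEvalAt (τ ∘ ⇑(s.orderEmbOfFin h₁)) t = g.altEvalAt (τ ∘ ⇑(s.orderEmbOfFin h₂)) t := by
  cases h₁; cases h₂; rfl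

/-- **Refinement = restrict ∘ pull back ∘ extend**: for every index map `τ : ι′ → ι` and comparison `φ`, the ordered refinement
★ `refineCochain τ φ` of an ordered cochain `g` is the restriction (★ `Full.res`) to increasing tuples of the order-free pull-back
(★ `Full.pullbackCochain τ φ`) of its alternating extension (★ `Full.ext`). [cite: StacksProject, Tag 01FG] -/
theorem res_pullbackCochain_ext (n : ℕ) (g : SysCochain M n) :
    res M' n (pullbackCochain τ φ n (ext M n g)) = refineCochain τ φ n g := by
  funext σ'
  rw [res_apply, pullbackCochain_apply, ext_apply, refineCochain_apply,
    SysCochain.map_altEvalAt g _ _ _ subset_rfl]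
  erw [map_app_altEvalAt τ φ g _ (image_orderEmbOfFin_simplex n σ').le (image_comp_eq τ _).le]
  congr 1
  exact altEvalAt_comp_orderEmbOfFin_congr τ g σ'.1 (card_simplex n σ') rfl _

/-- The same identity with the bundled maps: `refineLinear τ φ n = res ∘ₗ pullbackCochain ∘ₗ ext`. [cite: StacksProject, Tag 01FG] -/
theorem refineLinear_eq_res_comp_pullbackCochain_comp_ext (n : ℕ) :
    refineLinear τ φ n = res M' n ∘ₗ pullbackCochain τ φ n ∘ₗ ext M n := by
  apply LinearMap.ext
  intro g
  exact (res_pullbackCochain_ext τ φ n g).symm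

end Full

end OrderedCech

end Literature.Algebra.Homology

end
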